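import Mathlib.NumberTheory.NumberField.Discriminant.Basic
import Literature.NumberTheory.LFunctions.DedekindZetaPoissonProofs
import Literature.NumberTheory.LFunctions.DedekindZetaMellinProofs

/-!
# The theta transformation formula for ideals (Neukirch VII (3.6), (5.7), (5.8)) — proofs

Discharge of the named fact `Literature.NumberTheory.LFunctions.NumberField.thetaIdeal_inv`
(`Literature/NumberTheory/LFunctions/DedekindZetaTheta.lean`):
`θ_𝔞(i y⁻¹) = N(y)^{1/2} / (𝔑(𝔞) √|d_K|) · θ_{(𝔞𝔡)⁻¹}(iy)` for every nonzero fractional ideal `𝔞`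
and `y ∈ R_+^*` (Neukirch, *Algebraic Number Theory*, Ch. VII: (3.6) theta transformation, (5.7) the
dual lattice of an ideal, Ch. I (5.2) the volume of an ideal, as combined in the proof of (5.8)).

## Proof architecture

We run Neukirch's argument inside Mathlib's euclidean Minkowski space
`V = euclidean.mixedSpace K` (`toMixed : V ≃ K_ℝ = mixedSpace K`, volume preserving, with the
orthonormal basis `stdOrthonormalBasis` mapping to `stdBasis`).

* `scaleMixed c` is the coordinatewise scaling `x_w ↦ c_w x_w` of `K_ℝ`; for
  `c_w = (e_w y_w)^{1/2}` the lattice `Λ_y = toMixed⁻¹(c · j(𝔞))` satisfies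
  `∑_{g ∈ Λ_y} e^{-π‖g‖²} = θ_𝔞(iy)` (`‖toMixed⁻¹(c · j(a))‖² = ⟨ay, a⟩`, Neukirch's hermitian form with
  weight `2` at complex places versus Mathlib's weight `1`), and
  `vol(Λ_y) = |det c| vol(j(𝔞)) = N(y)^{1/2} 𝔑(𝔞) √|d_K|` (Mathlib `covolume_idealLattice`,
  `= 𝔑(𝔞) 2^{-r₂} √|d_K|`; the factor `2^{r₂}` of `det c` is exactly compensated).
* The dual lattice (for Mathlib's inner product) is `Λ_y' = toMixed⁻¹(c⁻¹ · *j((𝔞𝔡)⁻¹))` where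
  `*` is the involution `x_τ ↦ 2 x̄_τ` at complex places (Neukirch (5.7): "`Γ' = *(𝔞𝔡)⁻¹`"): the
  pairing is `⟪toMixed⁻¹(*j(a')), toMixed⁻¹(j(a))⟫ = Tr_{K/ℚ}(a'a)` (`trace_eq_sum_mult_mul_re`), the
  dual ideal is the `ℤ`-span of the trace-dual basis (Mathlib `FractionalIdeal.dual`,
  `Submodule.restrictScalars_traceDual`, `LinearMap.BilinForm.dualSubmodule_span_of_basis`), and
  `‖toMixed⁻¹(c⁻¹ · *j(a'))‖² = ⟨a' y⁻¹, a'⟩`.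
* Poisson summation in the decay form `Literature.NumberTheory.LFunctions.Fourier.tsum_eq_tsum_fourier_of_rpow_decay`
  (`DedekindZetaPoissonProofs.lean`) for the Gaussian `e^{-π‖v‖²}`, which is its own Fourier
  transform (Mathlib `fourier_gaussian_innerProductSpace`), gives
  `θ_𝔞(iy) = vol(Λ_y)⁻¹ θ_{(𝔞𝔡)⁻¹}(iy⁻¹)`, i.e. the formula at `y⁻¹`.

Finally Hecke's theorem `exists_isDedekindZetaContinuation_holds` (Neukirch VII (5.10), (5.11) (i))
follows by `exists_isDedekindZetaContinuation_of_thetaIdeal_inv` (`DedekindZetaMellinProofs.lean`),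
and with it the equivalence `extendedRiemannHypothesis_iff'_holds` of the two forms of ERH
(`NumberField.extendedRiemannHypothesis_iff'_of_exists`, `DedekindZetaProofs.lean`).

## References

* J. Neukirch, *Algebraic Number Theory*, Grundlehren 322, Springer 1999, Ch. VII (3.2), (3.6),
  (5.7), (5.8), (5.10), (5.11). [NeukirchANT1999]
-/

noncomputable section

open MeasureTheory Filter Set Submodule Complex NumberField NumberField.InfinitePlace
  NumberField.mixedEmbedding
open scoped Real Topology FourierTransform ENNReal NumberField nonZeroDivisors ComplexConjugate

namespace Literature.NumberTheory.LFunctions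

namespace NumberField

section FieldOnly

variable (K : Type*) [Field K]

/-! ## Coordinatewise scaling of the Minkowski space -/

/-- The coordinatewise scaling `x_w ↦ c_w x_w` of `K_ℝ = ℝ^{r₁} × ℂ^{r₂}` by a real vector
`c ∈ ∏_w ℝ` (the action of `R = [∏_τ ℝ]^+` on `K_ℝ`, Neukirch VII §3 / I §5). [cite: NeukirchANT1999, Ch. VII §3] -/
def scaleMixed (c : InfinitePlace K → ℝ) : mixedSpace K →ₗ[ℝ] mixedSpace K where
  toFun x := (fun w ↦ c w.1 * x.1 w, fun w ↦ (c w.1 : ℂ) * x.2 w)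
  map_add' x y := by ext <;> simp [mul_add]
  map_smul' r x := by
    ext <;> simp only [Prod.smul_fst, Prod.smul_snd, Pi.smul_apply, smul_eq_mul,
      Complex.real_smul, RingHom.id_apply] <;> ring

variable {K}

/-- Real coordinates of the scaling. [folklore] -/
@[simp] theorem scaleMixed_apply_fst (c : InfinitePlace K → ℝ) (x : mixedSpace K)
    (w : {w : InfinitePlace K // IsReal w}) : (scaleMixed K c x).1 w = c w.1 * x.1 w := rfl

/-- Complex coordinates of the scaling. [folklore] -/
@[simp] theorem scaleMixed_apply_snd (c : InfinitePlace K → ℝ) (x : mixedSpace K)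
    (w : {w : InfinitePlace K // IsComplex w}) : (scaleMixed K c x).2 w = (c w.1 : ℂ) * x.2 w := rfl

/-- `c · (c' · x) = (c c') · x`. [folklore] -/
theorem scaleMixed_scaleMixed (c c' : InfinitePlace K → ℝ) (x : mixedSpace K) :
    scaleMixed K c (scaleMixed K c' x) = scaleMixed K (c * c') x := by
  ext <;> simp <;> ring

/-- `1 · x = x`. [folklore] -/
@[simp] theorem scaleMixed_one (x : mixedSpace K) : scaleMixed K 1 x = x := by
  ext <;> simp

/-! ## The involution `*` at the complex places -/

/-- Neukirch's involution twisted by the weight `2` of the complex places: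
`*(x)_w = x_w` for real `w` and `*(x)_w = 2 x̄_w` for complex `w` (Neukirch VII §3, `*Γ'` in (5.7);
the factor `2` converts Mathlib's inner product on `K_ℝ`, which has weight `1` at complex places,
into the trace form). [cite: NeukirchANT1999, Ch. VII (5.7)] -/
def twistMixed (x : mixedSpace K) : mixedSpace K := (x.1, fun w ↦ 2 * conj (x.2 w))

/-- `*` is the identity at the real places. [folklore] -/
@[simp] theorem twistMixed_fst (x : mixedSpace K) : (twistMixed x).1 = x.1 := rfl

/-- `*` is `x ↦ 2x̄` at the complex places. [folklore] -/
@[simp] theorem twistMixed_snd (x : mixedSpace K) (w : {w : InfinitePlace K // IsComplex w}) :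
    (twistMixed x).2 w = 2 * conj (x.2 w) := rfl

/-- `*` is injective. [folklore] -/
theorem twistMixed_injective : Function.Injective (twistMixed (K := K)) := by
  intro x y h
  have h1 := congr_arg Prod.fst h
  have h2 := congr_arg Prod.snd h
  simp only [twistMixed_fst] at h1
  refine Prod.ext h1 (funext fun w ↦ ?_)
  have := congr_fun h2 w
  simp only [twistMixed, mul_eq_mul_left_iff, OfNat.ofNat_ne_zero, or_false] at this
  exact (starRingEnd ℂ).injective this  -- conj injective

/-- The scaling commutes with `*` (real scalars). [folklore] -/
theorem scaleMixed_twistMixed (c : InfinitePlace K → ℝ) (x : mixedSpace K) :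
    scaleMixed K c (twistMixed x) = twistMixed (scaleMixed K c x) := by
  ext w
  · simp
  · simp [twistMixed, map_mul, Complex.conj_ofReal]; ring

end FieldOnly

variable (K : Type*) [Field K] [NumberField K]

-- The `Fintype`/`DecidableEq` instances on `{w // IsReal w}`, `{w // IsComplex w}` and `index K`
-- behind Mathlib's `mixedSpace K`, `stdBasis K` and `euclidean.mixedSpace K` are the classical ones
-- (`open scoped Classical in` throughout `Mathlib.NumberTheory.NumberField.CanonicalEmbedding.Basic`);
-- every statement below mentions these types, so the whole development is classical.
open scoped Classical

/-! ## The trace through the infinite places -/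

/-- **The trace through the infinite places**: `Tr_{K/ℚ}(x) = ∑_w e_w Re(σ_w(x))`
(the real embeddings contribute `σ(x)`, each pair of complex embeddings `τ(x) + τ̄(x) = 2 Re τ(x)`;
Mathlib `trace_eq_sum_embeddings`, fibres of `InfinitePlace.mk`). [folklore] -/
theorem trace_eq_sum_mult_mul_re (x : K) :
    ((Algebra.trace ℚ K x : ℚ) : ℝ) = ∑ w : InfinitePlace K, (mult w : ℝ) * (w.embedding x).re := by
  classical
  have h := trace_eq_sum_embeddings ℂ (K := ℚ) (L := K) (x := x)
  have h2 : ((Algebra.trace ℚ K x : ℚ) : ℂ) = ∑ φ : K →+* ℂ, φ x := by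
    rw [eq_ratCast] at h
    rw [h, ← Fintype.sum_equiv RingHom.equivRatAlgHom (fun φ : K →+* ℂ ↦ φ x)
      (fun σ : K →ₐ[ℚ] ℂ ↦ σ x) (fun φ ↦ by simp [RingHom.equivRatAlgHom_apply])]
  have h3 : ((Algebra.trace ℚ K x : ℚ) : ℝ) = (∑ φ : K →+* ℂ, φ x).re := by
    rw [← h2]; norm_cast
  rw [h3, Complex.re_sum, ← Finset.sum_fiberwise Finset.univ InfinitePlace.mk (fun φ : K →+* ℂ ↦ (φ x).re)]
  refine Finset.sum_congr rfl fun w _ ↦ ?_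
  have hφ : ∀ φ ∈ ({φ ∈ Finset.univ | InfinitePlace.mk φ = w} : Finset (K →+* ℂ)),
      (φ x).re = (w.embedding x).re := by
    intro φ hφ
    have hw : InfinitePlace.mk φ = InfinitePlace.mk w.embedding := by
      rw [(Finset.mem_filter.mp hφ).2, mk_embedding]
    rcases mk_eq_iff.mp hw with h | h
    · rw [h]
    · rw [← h, ComplexEmbedding.conjugate_coe_eq, Complex.conj_re]
  rw [Finset.sum_congr rfl hφ, Finset.sum_const, card_filter_mk_eq, nsmul_eq_mul]

variable {K}

/-- For nonvanishing `c` the scaling is a (continuous) linear automorphism of `K_ℝ` with inverse the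
scaling by `c⁻¹`. [folklore] -/
def scaleMixedEquiv (c : InfinitePlace K → ℝ) (hc : ∀ w, c w ≠ 0) : mixedSpace K ≃L[ℝ] mixedSpace K :=
  (LinearEquiv.ofLinear (scaleMixed K c) (scaleMixed K c⁻¹)
    (by
      refine LinearMap.ext fun x ↦ ?_
      simp [scaleMixed_scaleMixed, show c * c⁻¹ = 1 from funext fun w ↦ mul_inv_cancel₀ (hc w)])
    (by
      refine LinearMap.ext fun x ↦ ?_
      simp [scaleMixed_scaleMixed, show c⁻¹ * c = 1 from funext fun w ↦ inv_mul_cancel₀ (hc w)])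
    ).toContinuousLinearEquiv

/-- The scaling equivalence acts as the scaling. [folklore] -/
@[simp] theorem scaleMixedEquiv_apply (c : InfinitePlace K → ℝ) (hc : ∀ w, c w ≠ 0) (x : mixedSpace K) :
    scaleMixedEquiv c hc x = scaleMixed K c x := rfl

/-- The inverse of the scaling by `c` is the scaling by `c⁻¹`. [folklore] -/
@[simp] theorem scaleMixedEquiv_symm_apply (c : InfinitePlace K → ℝ) (hc : ∀ w, c w ≠ 0)
    (x : mixedSpace K) : (scaleMixedEquiv c hc).symm x = scaleMixed K c⁻¹ x := rfl

/-- The scaling equivalence as a linear map. [folklore] -/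
theorem coe_scaleMixedEquiv (c : InfinitePlace K → ℝ) (hc : ∀ w, c w ≠ 0) :
    ((scaleMixedEquiv c hc : mixedSpace K ≃L[ℝ] mixedSpace K) : mixedSpace K →ₗ[ℝ] mixedSpace K) =
      scaleMixed K c := rfl

/-! ### Coordinates and determinant of the scaling -/

/-- The scaling factor attached to a coordinate of `stdBasis`: `c_w` for the coordinate at a real
`w` and for both coordinates at a complex `w`. [folklore] -/
def scaleIndex (c : InfinitePlace K → ℝ) : index K → ℝ :=
  fun i ↦ Sum.elim (fun w ↦ c w.1) (fun p ↦ c p.1.1) i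

omit [NumberField K] in
/-- The factor at a real coordinate. [folklore] -/
@[simp] theorem scaleIndex_inl (c : InfinitePlace K → ℝ) (w : {w : InfinitePlace K // IsReal w}) :
    scaleIndex c (Sum.inl w) = c w.1 := rfl

omit [NumberField K] in
/-- The factor at a complex coordinate. [folklore] -/
@[simp] theorem scaleIndex_inr (c : InfinitePlace K → ℝ)
    (p : {w : InfinitePlace K // IsComplex w} × Fin 2) : scaleIndex c (Sum.inr p) = c p.1.1 := rfl

/-- The scaling acts diagonally on the coordinates of `stdBasis`. [folklore] -/
theorem stdBasis_repr_scaleMixed (c : InfinitePlace K → ℝ) (x : mixedSpace K) (i : index K) :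
    (stdBasis K).repr (scaleMixed K c x) i = scaleIndex c i * (stdBasis K).repr x i := by
  classical
  rcases i with w | ⟨w, k⟩
  · simp
  · fin_cases k
    · simp [Complex.mul_re]
    · simp [Complex.mul_im]

/-- The matrix of the scaling in `stdBasis` is diagonal. [folklore] -/
theorem toMatrix_scaleMixed (c : InfinitePlace K → ℝ) :
    LinearMap.toMatrix (stdBasis K) (stdBasis K) (scaleMixed K c) = Matrix.diagonal (scaleIndex c) := by
  classical
  ext i j
  rw [LinearMap.toMatrix_apply, stdBasis_repr_scaleMixed, Module.Basis.repr_self, Matrix.diagonal_apply,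
    Finsupp.single_apply]
  split_ifs with h1 h2 h2
  · rw [mul_one]
  · exact (h2 h1.symm).elim
  · exact (h1 h2.symm).elim
  · rw [mul_zero]

/-- **Determinant of the scaling**: `det(x ↦ c·x) = ∏_w c_w^{e_w}`. [folklore] -/
theorem det_scaleMixed (c : InfinitePlace K → ℝ) :
    LinearMap.det (scaleMixed K c) = ∏ w : InfinitePlace K, c w ^ mult w := by
  classical
  rw [← LinearMap.det_toMatrix (stdBasis K), toMatrix_scaleMixed, Matrix.det_diagonal,
    Fintype.prod_sum_type, Fintype.prod_prod_type]
  simp only [scaleIndex_inl, scaleIndex_inr, Fin.prod_univ_two]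
  rw [prod_eq_prod_mul_prod (fun w ↦ c w ^ mult w)]
  simp only [mult_isReal, pow_one, mult_isComplex, sq]

/-! ## Inner products in the euclidean Minkowski space -/

/-- Coordinates in the orthonormal basis of `V` are the `stdBasis`-coordinates in `K_ℝ`. [folklore] -/
theorem stdOrthonormalBasis_repr_apply (v : euclidean.mixedSpace K) (i : index K) :
    (euclidean.stdOrthonormalBasis K).repr v i = (stdBasis K).repr (euclidean.toMixed K v) i := by
  have h := congr_arg (fun B : Module.Basis (index K) ℝ (mixedSpace K) ↦ B.repr (euclidean.toMixed K v) i)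
    (euclidean.stdOrthonormalBasis_map_eq K)
  simp only [Module.Basis.map_repr, LinearEquiv.trans_apply, OrthonormalBasis.coe_toBasis_repr_apply] at h
  rw [← h]
  congr 3

/-- **The inner product of `V` in Minkowski coordinates**:
`⟪toMixed⁻¹ u, toMixed⁻¹ z⟫ = ∑_{w real} u_w z_w + ∑_{w complex} (Re u_w Re z_w + Im u_w Im z_w)`
(weight `1` at the complex places). [folklore] -/
theorem inner_toMixed_symm (u z : mixedSpace K) :
    inner ℝ ((euclidean.toMixed K).symm u) ((euclidean.toMixed K).symm z) =
      ∑ w : {w : InfinitePlace K // IsReal w}, u.1 w * z.1 w +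
        ∑ w : {w : InfinitePlace K // IsComplex w}, ((u.2 w).re * (z.2 w).re + (u.2 w).im * (z.2 w).im) := by
  classical
  set b := euclidean.stdOrthonormalBasis K
  rw [← b.repr.inner_map_map]
  have hcoord : ∀ (x : mixedSpace K) (i : index K),
      b.repr ((euclidean.toMixed K).symm x) i = (stdBasis K).repr x i := by
    intro x i
    rw [stdOrthonormalBasis_repr_apply, ContinuousLinearEquiv.apply_symm_apply]
  have hinner : inner ℝ (b.repr ((euclidean.toMixed K).symm u)) (b.repr ((euclidean.toMixed K).symm z)) =
      ∑ i, b.repr ((euclidean.toMixed K).symm u) i * b.repr ((euclidean.toMixed K).symm z) i := by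
    simp only [PiLp.inner_apply, RCLike.inner_apply, conj_trivial]
    exact Finset.sum_congr rfl fun i _ ↦ mul_comm _ _
  rw [hinner]
  simp_rw [hcoord]
  rw [Fintype.sum_sum_type, Fintype.sum_prod_type]
  simp only [Fin.sum_univ_two, stdBasis_apply_isReal, stdBasis_apply_isComplex_fst,
    stdBasis_apply_isComplex_snd]

/-- `‖toMixed⁻¹ u‖² = ∑_{w real} u_w² + ∑_{w complex} |u_w|²`. [folklore] -/
theorem norm_sq_toMixed_symm (u : mixedSpace K) :
    ‖(euclidean.toMixed K).symm u‖ ^ 2 =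
      ∑ w : {w : InfinitePlace K // IsReal w}, u.1 w ^ 2 +
        ∑ w : {w : InfinitePlace K // IsComplex w}, ‖u.2 w‖ ^ 2 := by
  rw [← real_inner_self_eq_norm_sq, inner_toMixed_symm]
  congr 1
  · exact Finset.sum_congr rfl fun w _ ↦ by ring
  · exact Finset.sum_congr rfl fun w _ ↦ by rw [Complex.sq_norm, Complex.normSq_apply]

/-- The scaling is self-adjoint: `⟪toMixed⁻¹(c·u), toMixed⁻¹(c'·z)⟫ = ⟪toMixed⁻¹ u, toMixed⁻¹ z⟫`
whenever `c c' = 1`. [folklore] -/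
theorem inner_scaleMixed_scaleMixed {c c' : InfinitePlace K → ℝ} (h : ∀ w, c w * c' w = 1)
    (u z : mixedSpace K) :
    inner ℝ ((euclidean.toMixed K).symm (scaleMixed K c u)) ((euclidean.toMixed K).symm (scaleMixed K c' z)) =
      inner ℝ ((euclidean.toMixed K).symm u) ((euclidean.toMixed K).symm z) := by
  rw [inner_toMixed_symm, inner_toMixed_symm]
  congr 1
  · refine Finset.sum_congr rfl fun w _ ↦ ?_
    simp only [scaleMixed_apply_fst]
    calc c w.1 * u.1 w * (c' w.1 * z.1 w) = (c w.1 * c' w.1) * (u.1 w * z.1 w) := by ring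
      _ = u.1 w * z.1 w := by rw [h, one_mul]
  · refine Finset.sum_congr rfl fun w _ ↦ ?_
    simp only [scaleMixed_apply_snd, Complex.re_ofReal_mul, Complex.im_ofReal_mul]
    calc c w.1 * (u.2 w).re * (c' w.1 * (z.2 w).re) + c w.1 * (u.2 w).im * (c' w.1 * (z.2 w).im)
        = (c w.1 * c' w.1) * ((u.2 w).re * (z.2 w).re + (u.2 w).im * (z.2 w).im) := by ring
      _ = (u.2 w).re * (z.2 w).re + (u.2 w).im * (z.2 w).im := by rw [h, one_mul]

/-- **The trace pairing** (Neukirch VII (5.7)): `⟪toMixed⁻¹(*j(a')), toMixed⁻¹(j(a))⟫ = Tr_{K/ℚ}(a'a)`.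
[cite: NeukirchANT1999, Ch. VII (5.7)] -/
theorem inner_twistMixed_mixedEmbedding (a' a : K) :
    inner ℝ ((euclidean.toMixed K).symm (twistMixed (mixedEmbedding K a')))
      ((euclidean.toMixed K).symm (mixedEmbedding K a)) = ((Algebra.trace ℚ K (a' * a) : ℚ) : ℝ) := by
  rw [inner_toMixed_symm, trace_eq_sum_mult_mul_re, sum_eq_sum_add_sum]
  congr 1
  · refine Finset.sum_congr rfl fun w _ ↦ ?_
    simp only [twistMixed_fst, mixedEmbedding_apply_isReal, mult_isReal, Nat.cast_one, one_mul]
    rw [← map_mul]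
    have h := embedding_of_isReal_apply w.2 (a' * a)
    rw [← h, Complex.ofReal_re]
  · refine Finset.sum_congr rfl fun w _ ↦ ?_
    simp only [twistMixed_snd, mixedEmbedding_apply_isComplex, mult_isComplex, Nat.cast_ofNat, map_mul,
      Complex.mul_re, Complex.mul_im, Complex.conj_re, Complex.conj_im, Complex.re_ofNat, Complex.im_ofNat]
    ring

/-! ### Norms of the lattice vectors: Neukirch's hermitian form `⟨ay, a⟩` -/

/-- For `c_w = (e_w t_w)^{1/2}`: `‖toMixed⁻¹(c · j(a))‖² = ∑_w e_w t_w |a|_w² = ⟨at, a⟩`. [folklore] -/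
theorem norm_sq_scaleMixed_mixedEmbedding {t : InfinitePlace K → ℝ} (ht : ∀ w, 0 ≤ t w) (a : K) :
    ‖(euclidean.toMixed K).symm (scaleMixed K (fun w ↦ Real.sqrt (mult w * t w)) (mixedEmbedding K a))‖ ^ 2 =
      minkowskiQuadForm K t a := by
  rw [norm_sq_toMixed_symm, minkowskiQuadForm, sum_eq_sum_add_sum]
  congr 1
  · refine Finset.sum_congr rfl fun w _ ↦ ?_
    simp only [scaleMixed_apply_fst, mixedEmbedding_apply_isReal, mult_isReal, Nat.cast_one, one_mul]
    rw [mul_pow, Real.sq_sqrt (ht _), ← norm_embedding_of_isReal w.2 a, Real.norm_eq_abs, sq_abs]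
  · refine Finset.sum_congr rfl fun w _ ↦ ?_
    simp only [scaleMixed_apply_snd, mixedEmbedding_apply_isComplex, mult_isComplex, Nat.cast_ofNat]
    rw [norm_mul, Complex.norm_real, mul_pow, Real.norm_eq_abs, sq_abs, norm_embedding_eq,
      Real.sq_sqrt (by have := ht w.1; positivity)]

/-- For `c_w = (e_w t_w)^{1/2}`, `t_w > 0`: `‖toMixed⁻¹(c⁻¹ · *j(a'))‖² = ∑_w e_w t_w⁻¹ |a'|_w² =
⟨a' t⁻¹, a'⟩`. [folklore] -/
theorem norm_sq_scaleMixed_inv_twistMixed {t : InfinitePlace K → ℝ} (ht : ∀ w, 0 < t w) (a' : K) :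
    ‖(euclidean.toMixed K).symm (scaleMixed K (fun w ↦ Real.sqrt (mult w * t w))⁻¹
      (twistMixed (mixedEmbedding K a')))‖ ^ 2 = minkowskiQuadForm K (fun w ↦ (t w)⁻¹) a' := by
  rw [norm_sq_toMixed_symm, minkowskiQuadForm, sum_eq_sum_add_sum]
  congr 1
  · refine Finset.sum_congr rfl fun w _ ↦ ?_
    simp only [scaleMixed_apply_fst, Pi.inv_apply, twistMixed_fst, mixedEmbedding_apply_isReal, mult_isReal,
      Nat.cast_one, one_mul]
    rw [mul_pow, inv_pow, Real.sq_sqrt (ht _).le, ← norm_embedding_of_isReal w.2 a', Real.norm_eq_abs, sq_abs]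
  · refine Finset.sum_congr rfl fun w _ ↦ ?_
    simp only [scaleMixed_apply_snd, Pi.inv_apply, twistMixed_snd, mixedEmbedding_apply_isComplex,
      mult_isComplex, Nat.cast_ofNat]
    rw [norm_mul, Complex.norm_real, norm_mul, Complex.norm_conj, norm_embedding_eq, Real.norm_eq_abs,
      abs_inv, mul_pow, mul_pow, inv_pow, sq_abs, Real.sq_sqrt (by have := ht w.1; positivity)]
    have : (t w.1 : ℝ) ≠ 0 := (ht _).ne'
    field_simp
    norm_num

/-! ## The scaled ideal lattice `Λ = toMixed⁻¹(c · j(𝔞)) ⊂ V` -/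

/-- The scaling equivalence as a function. [folklore] -/
@[simp] theorem coe_scaleMixedEquiv' (c : InfinitePlace K → ℝ) (hc : ∀ w, c w ≠ 0) :
    ⇑(scaleMixedEquiv c hc) = ⇑(scaleMixed K c) := rfl

variable (K) in
/-- The linear isomorphism `e_c : V ≃ K_ℝ`, `v ↦ c⁻¹ · toMixed(v)`; the scaled ideal lattice is
`e_c⁻¹(j(𝔞))`. [folklore] -/
def latticeEquiv (c : InfinitePlace K → ℝ) (hc : ∀ w, c w ≠ 0) :
    euclidean.mixedSpace K ≃L[ℝ] mixedSpace K :=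
  (euclidean.toMixed K).trans (scaleMixedEquiv c hc).symm

/-- `e_c(v) = c⁻¹ · toMixed(v)`. [folklore] -/
@[simp] theorem latticeEquiv_apply (c : InfinitePlace K → ℝ) (hc : ∀ w, c w ≠ 0)
    (v : euclidean.mixedSpace K) :
    latticeEquiv K c hc v = scaleMixed K c⁻¹ (euclidean.toMixed K v) := rfl

/-- `e_c⁻¹(x) = toMixed⁻¹(c · x)`. [folklore] -/
@[simp] theorem latticeEquiv_symm_apply (c : InfinitePlace K → ℝ) (hc : ∀ w, c w ≠ 0)
    (x : mixedSpace K) :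
    (latticeEquiv K c hc).symm x = (euclidean.toMixed K).symm (scaleMixed K c x) := rfl

/-- **The scaled ideal lattice** `Λ_c(𝔞) = toMixed⁻¹(c · j(𝔞))` in the euclidean Minkowski space
(for `c_w = (e_w y_w)^{1/2}` this is the lattice whose Gaussian sum is `θ_𝔞(iy)`; Neukirch VII §5,
the lattice `Γ = 𝔞 ⊂ K_ℝ` with the hermitian form `⟨xy, x⟩`). [cite: NeukirchANT1999, Ch. VII §5] -/
abbrev scaledIdealLattice (c : InfinitePlace K → ℝ) (hc : ∀ w, c w ≠ 0)
    (I : (FractionalIdeal (𝓞 K)⁰ K)ˣ) : Submodule ℤ (euclidean.mixedSpace K) :=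
  ZLattice.comap ℝ (mixedEmbedding.idealLattice K I) (latticeEquiv K c hc).toLinearMap

/-- Membership in the scaled ideal lattice. [folklore] -/
theorem mem_scaledIdealLattice {c : InfinitePlace K → ℝ} {hc : ∀ w, c w ≠ 0}
    {I : (FractionalIdeal (𝓞 K)⁰ K)ˣ} {v : euclidean.mixedSpace K} :
    v ∈ scaledIdealLattice c hc I ↔
      ∃ a : K, a ∈ ((I : FractionalIdeal (𝓞 K)⁰ K) : Set K) ∧
        v = (euclidean.toMixed K).symm (scaleMixed K c (mixedEmbedding K a)) := by
  rw [scaledIdealLattice, ZLattice.comap, Submodule.mem_comap, mem_idealLattice]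
  constructor
  · rintro ⟨a, ha, hav⟩
    refine ⟨a, ha, ?_⟩
    rw [← latticeEquiv_symm_apply c hc, ContinuousLinearEquiv.eq_symm_apply]
    exact hav.symm
  · rintro ⟨a, ha, rfl⟩
    refine ⟨a, ha, ?_⟩
    rw [← latticeEquiv_symm_apply c hc]
    exact ((latticeEquiv K c hc).apply_symm_apply _).symm

/-- The bijection `a ↦ toMixed⁻¹(c · j(a))` between `𝔞` and the scaled ideal lattice. [folklore] -/
def idealEquivScaledIdealLattice (c : InfinitePlace K → ℝ) (hc : ∀ w, c w ≠ 0)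
    (I : (FractionalIdeal (𝓞 K)⁰ K)ˣ) :
    ((I : FractionalIdeal (𝓞 K)⁰ K)) ≃ scaledIdealLattice c hc I :=
  (idealEquivIdealLattice K I).trans
    (ZLattice.comap_equiv ℝ (mixedEmbedding.idealLattice K I) (latticeEquiv K c hc).toLinearEquiv).toEquiv

/-- `idealEquivScaledIdealLattice` is `a ↦ toMixed⁻¹(c · j(a))` on points. [folklore] -/
@[simp] theorem coe_idealEquivScaledIdealLattice_apply (c : InfinitePlace K → ℝ) (hc : ∀ w, c w ≠ 0)
    (I : (FractionalIdeal (𝓞 K)⁰ K)ˣ) (a : (I : FractionalIdeal (𝓞 K)⁰ K)) :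
    ((idealEquivScaledIdealLattice c hc I a : scaledIdealLattice c hc I) : euclidean.mixedSpace K) =
      (euclidean.toMixed K).symm (scaleMixed K c (mixedEmbedding K (a : K))) := by
  simp [idealEquivScaledIdealLattice, ZLattice.comap_equiv_apply]

/-! ### The covolume of the scaled ideal lattice -/

/-- A `ℤ`-basis of the ideal lattice `j(𝔞)` whose associated `ℝ`-basis of `K_ℝ` is Mathlib's
`fractionalIdealLatticeBasis`. [folklore] -/
def idealLatticeZBasis (I : (FractionalIdeal (𝓞 K)⁰ K)ˣ) :
    Module.Basis (Module.Free.ChooseBasisIndex ℤ I) ℤ (mixedEmbedding.idealLattice K I) :=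
  ((fractionalIdealLatticeBasis K I).restrictScalars ℤ).map
    (LinearEquiv.ofEq _ _ (span_idealLatticeBasis K I))

/-- The `ℝ`-basis attached to `idealLatticeZBasis` is `fractionalIdealLatticeBasis`. [folklore] -/
theorem idealLatticeZBasis_ofZLatticeBasis (I : (FractionalIdeal (𝓞 K)⁰ K)ˣ) :
    (idealLatticeZBasis I).ofZLatticeBasis ℝ (mixedEmbedding.idealLattice K I) =
      fractionalIdealLatticeBasis K I := by
  refine Module.Basis.eq_of_apply_eq fun i ↦ ?_
  rw [Module.Basis.ofZLatticeBasis_apply, idealLatticeZBasis, Module.Basis.map_apply,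
    LinearEquiv.coe_ofEq_apply, Module.Basis.restrictScalars_apply]

/-- **Covolume of a comap along a linear isomorphism composed with a volume-preserving one**:
`vol(Λ_c(𝔞)) = |det(c ·)| vol(j(𝔞))`. [folklore] -/
theorem covolume_scaledIdealLattice (c : InfinitePlace K → ℝ) (hc : ∀ w, c w ≠ 0)
    (I : (FractionalIdeal (𝓞 K)⁰ K)ˣ) :
    ZLattice.covolume (scaledIdealLattice c hc I) =
      |∏ w : InfinitePlace K, c w ^ mult w| * ZLattice.covolume (mixedEmbedding.idealLattice K I) := by
  set L := mixedEmbedding.idealLattice K I with hL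
  set e := latticeEquiv K c hc with he
  set bL := idealLatticeZBasis I with hbL
  set F := ZSpan.fundamentalDomain (bL.ofZLatticeBasis ℝ L) with hF
  have hFm : MeasurableSet F := ZSpan.fundamentalDomain_measurableSet _
  -- the fundamental domain of the comap lattice is `e⁻¹ F`
  have h1 : ZLattice.covolume (scaledIdealLattice c hc I) = (volume (e.symm '' F)).toReal := by
    rw [ZLattice.covolume_eq_measure_fundamentalDomain _ volume
      (ZLattice.isAddFundamentalDomain (bL.ofZLatticeComap ℝ L e.toLinearEquiv) volume),
      measureReal_def, Module.Basis.ofZLatticeBasis_comap, ← ZSpan.map_fundamentalDomain]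
    rfl
  -- `e⁻¹ F = toMixed⁻¹ (c · F)`
  have h2 : e.symm '' F = (euclidean.toMixed K) ⁻¹' (scaleMixed K c '' F) := by
    rw [← ContinuousLinearEquiv.image_symm_eq_preimage, Set.image_image]
    rfl
  have hSm : MeasurableSet (scaleMixed K c '' F) := by
    have := ((scaleMixedEquiv c hc).toHomeomorph.toMeasurableEquiv.measurableSet_image).mpr hFm
    simpa using this
  have h3 : volume (e.symm '' F) = ENNReal.ofReal |∏ w : InfinitePlace K, c w ^ mult w| * volume F := by
    rw [h2, (euclidean.volumePreserving_toMixed K).measure_preimage hSm.nullMeasurableSet,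
      Measure.addHaar_image_linearMap, det_scaleMixed]
  have h4 : ZLattice.covolume L = (volume F).toReal := by
    rw [ZLattice.covolume_eq_measure_fundamentalDomain L volume (ZLattice.isAddFundamentalDomain bL volume),
      measureReal_def]
  rw [h1, h3, h4, ENNReal.toReal_mul, ENNReal.toReal_ofReal (abs_nonneg _)]

/-- The Jacobian of the scaling `c_w = (e_w t_w)^{1/2}`: `∏_w c_w^{e_w} = 2^{r₂} N(t)^{1/2}`. [folklore] -/
theorem prod_sqrt_mult_mul_pow_mult {t : InfinitePlace K → ℝ} (ht : ∀ w, 0 ≤ t w) :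
    ∏ w : InfinitePlace K, Real.sqrt (mult w * t w) ^ mult w =
      2 ^ nrComplexPlaces K * Real.sqrt (mixedNorm K t) := by
  have hpos : ∀ w, 0 ≤ (mult w : ℝ) * t w := fun w ↦ by have := ht w; positivity
  -- compare squares of nonnegative reals
  have hl : 0 ≤ ∏ w : InfinitePlace K, Real.sqrt (mult w * t w) ^ mult w :=
    Finset.prod_nonneg fun w _ ↦ pow_nonneg (Real.sqrt_nonneg _) _
  have hN : 0 ≤ mixedNorm K t := Finset.prod_nonneg fun w _ ↦ pow_nonneg (ht w) _
  have hr : 0 ≤ (2 : ℝ) ^ nrComplexPlaces K * Real.sqrt (mixedNorm K t) := by positivity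
  rw [← Real.sqrt_sq hl, ← Real.sqrt_sq hr]
  congr 1
  rw [mul_pow, Real.sq_sqrt hN, ← Finset.prod_pow, mixedNorm]
  have hsq : ∀ w, (Real.sqrt (mult w * t w) ^ mult w) ^ 2 = (mult w : ℝ) ^ mult w * t w ^ mult w := by
    intro w
    rw [← pow_mul, mul_comm (mult w) 2, pow_mul, Real.sq_sqrt (hpos w), mul_pow]
  simp_rw [hsq]
  rw [Finset.prod_mul_distrib]
  congr 1
  rw [prod_eq_prod_mul_prod (fun w : InfinitePlace K ↦ (mult w : ℝ) ^ mult w)]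
  simp only [mult_isReal, Nat.cast_one, one_pow, Finset.prod_const_one, one_mul, mult_isComplex,
    Nat.cast_ofNat, Finset.prod_const, Finset.card_univ, nrComplexPlaces]
  rw [← pow_mul, ← pow_mul, mul_comm]

/-- **Volume of the scaled ideal lattice** (Neukirch VII, proof of (5.8): `vol(Γ) = 𝔑(𝔞) |d_K|^{1/2}`
for the Minkowski measure, combined with the Jacobian of `y`): for `c_w = (e_w t_w)^{1/2}`,
`vol(Λ_c(𝔞)) = N(t)^{1/2} 𝔑(𝔞) |d_K|^{1/2}` (Mathlib's `covolume_idealLattice = 𝔑(𝔞) 2^{-r₂} √|d_K|`;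
the `2^{-r₂}` is the ratio of Mathlib's Lebesgue measure to Neukirch's Minkowski measure and is
cancelled by the Jacobian). [cite: NeukirchANT1999, Ch. VII, proof of (5.8)] -/
theorem covolume_scaledIdealLattice_sqrt {t : InfinitePlace K → ℝ} (ht : ∀ w, 0 < t w)
    (hc : ∀ w, Real.sqrt (mult w * t w) ≠ 0) (I : (FractionalIdeal (𝓞 K)⁰ K)ˣ) :
    ZLattice.covolume (scaledIdealLattice (fun w ↦ Real.sqrt (mult w * t w)) hc I) =
      Real.sqrt (mixedNorm K t) * ((FractionalIdeal.absNorm (I : FractionalIdeal (𝓞 K)⁰ K) : ℝ) *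
        Real.sqrt |(discr K : ℝ)|) := by
  rw [covolume_scaledIdealLattice, prod_sqrt_mult_mul_pow_mult (fun w ↦ (ht w).le),
    covolume_idealLattice, abs_of_nonneg (by positivity)]
  have h2 : (2 : ℝ) ^ nrComplexPlaces K * 2⁻¹ ^ nrComplexPlaces K = 1 := by
    rw [← mul_pow, mul_inv_cancel₀ two_ne_zero, one_pow]
  linear_combination (Real.sqrt (mixedNorm K t) * (FractionalIdeal.absNorm (I : FractionalIdeal (𝓞 K)⁰ K) : ℝ) *
    Real.sqrt |(discr K : ℝ)|) * h2

/-! ## The dual lattice `Λ_c(𝔞)' = toMixed⁻¹(c⁻¹ · *j((𝔞𝔡)⁻¹))` (Neukirch VII (5.7)) -/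

/-- **The dual ideal is the `ℤ`-span of the trace-dual basis**: `(𝔞𝔡)⁻¹ = ⊕ ℤ bᵢ^∨` where
`Tr(bᵢ^∨ bⱼ) = δᵢⱼ` for a `ℤ`-basis `b` of `𝔞` (Mathlib `FractionalIdeal.dual`,
`Submodule.restrictScalars_traceDual`, `LinearMap.BilinForm.dualSubmodule_span_of_basis`).
[folklore] -/
theorem mem_dual_iff_mem_span_dualBasis (I : (FractionalIdeal (𝓞 K)⁰ K)ˣ) (x : K) :
    x ∈ FractionalIdeal.dual ℤ ℚ (I : FractionalIdeal (𝓞 K)⁰ K) ↔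
      x ∈ span ℤ (Set.range ((Algebra.traceForm ℚ K).dualBasis (traceForm_nondegenerate ℚ K)
        (basisOfFractionalIdeal K I))) := by
  have hI : (I : FractionalIdeal (𝓞 K)⁰ K) ≠ 0 := I.ne_zero
  have h1 : ((I : FractionalIdeal (𝓞 K)⁰ K) : Submodule (𝓞 K) K).restrictScalars ℤ =
      span ℤ (Set.range (basisOfFractionalIdeal K I)) := by
    ext y
    rw [Submodule.restrictScalars_mem, mem_span_basisOfFractionalIdeal]
    rfl
  rw [← FractionalIdeal.mem_coe, FractionalIdeal.coe_dual ℤ ℚ hI,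
    ← Submodule.restrictScalars_mem ℤ, Submodule.restrictScalars_traceDual, h1,
    LinearMap.BilinForm.dualSubmodule_span_of_basis]

/-- The pairing of a dual vector `toMixed⁻¹(c⁻¹ · *j(a'))` with a lattice vector
`toMixed⁻¹(c · j(a))` is the trace `Tr(a'a)`. [folklore] -/
theorem inner_dualVector_latticeVector {c : InfinitePlace K → ℝ} (hc : ∀ w, c w ≠ 0) (a' a : K) :
    inner ℝ ((euclidean.toMixed K).symm (scaleMixed K c⁻¹ (twistMixed (mixedEmbedding K a'))))
      ((euclidean.toMixed K).symm (scaleMixed K c (mixedEmbedding K a))) =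
        ((Algebra.trace ℚ K (a' * a) : ℚ) : ℝ) := by
  rw [inner_scaleMixed_scaleMixed (c := c⁻¹) (c' := c) (fun w ↦ inv_mul_cancel₀ (hc w)),
    inner_twistMixed_mixedEmbedding]

/-- Dual vectors lie in the dual lattice (Neukirch VII (5.7), "`⊇`"): `Tr(a'𝔞) ⊆ ℤ` for
`a' ∈ (𝔞𝔡)⁻¹` (Mathlib `FractionalIdeal.mem_dual`). [cite: NeukirchANT1999, Ch. VII (5.7)] -/
theorem dualVector_mem_dualLattice {c : InfinitePlace K → ℝ} (hc : ∀ w, c w ≠ 0)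
    (I : (FractionalIdeal (𝓞 K)⁰ K)ˣ) {a' : K}
    (ha' : a' ∈ FractionalIdeal.dual ℤ ℚ (I : FractionalIdeal (𝓞 K)⁰ K)) :
    (euclidean.toMixed K).symm (scaleMixed K c⁻¹ (twistMixed (mixedEmbedding K a'))) ∈
      Literature.Algebra.EuclideanLattices.dualLattice (scaledIdealLattice c hc I) := by
  rw [Literature.Algebra.EuclideanLattices.mem_dualLattice]
  intro y hy
  obtain ⟨a, ha, rfl⟩ := mem_scaledIdealLattice.mp hy
  rw [inner_dualVector_latticeVector hc]
  have hI : (I : FractionalIdeal (𝓞 K)⁰ K) ≠ 0 := I.ne_zero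
  obtain ⟨n, hn⟩ := (FractionalIdeal.mem_dual hI).mp ha' a ha
  refine ⟨n, ?_⟩
  rw [Algebra.traceForm_apply] at hn
  rw [← hn]
  simp

/-- **The dual lattice of the scaled ideal lattice** (Neukirch VII (5.7) Lemma, "the lattice dual
to `Γ = 𝔞` is `*Γ' = *(𝔞𝔡)⁻¹`", transported by the self-adjoint scaling): the map
`a' ↦ toMixed⁻¹(c⁻¹ · *j(a'))` is a bijection from `(𝔞𝔡)⁻¹ = FractionalIdeal.dual ℤ ℚ 𝔞` onto
`Literature.Lattice.dualLattice (Λ_c(𝔞))`. Surjectivity: a dual vector `x` has integral pairings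
`nᵢ = ⟪x, toMixed⁻¹(c·j(bᵢ))⟫` with a `ℤ`-basis `b` of `𝔞`, and `x` is the image of
`a' = ∑ nᵢ bᵢ^∨` (expand both in the basis dual to `toMixed⁻¹(c·j(bᵢ))`).
[cite: NeukirchANT1999, Ch. VII (5.7)] -/
def dualIdealEquivDualLattice (c : InfinitePlace K → ℝ) (hc : ∀ w, c w ≠ 0)
    (I : (FractionalIdeal (𝓞 K)⁰ K)ˣ) :
    (FractionalIdeal.dual ℤ ℚ (I : FractionalIdeal (𝓞 K)⁰ K) : FractionalIdeal (𝓞 K)⁰ K) ≃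
      Literature.Algebra.EuclideanLattices.dualLattice (scaledIdealLattice c hc I) := by
  refine Equiv.ofBijective
    (fun a' ↦ ⟨(euclidean.toMixed K).symm (scaleMixed K c⁻¹ (twistMixed (mixedEmbedding K (a' : K)))),
      dualVector_mem_dualLattice hc I a'.2⟩) ⟨?_, ?_⟩
  · -- injectivity
    intro a₁ a₂ h
    have h1 := congr_arg (fun v : Literature.Algebra.EuclideanLattices.dualLattice (scaledIdealLattice c hc I) ↦
      scaleMixed K c (euclidean.toMixed K (v : euclidean.mixedSpace K))) h
    simp only [ContinuousLinearEquiv.apply_symm_apply, scaleMixed_scaleMixed,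
      show c * c⁻¹ = 1 from funext fun w ↦ mul_inv_cancel₀ (hc w), scaleMixed_one] at h1
    exact Subtype.ext (mixedEmbedding_injective K (twistMixed_injective h1))
  · -- surjectivity
    rintro ⟨x, hx⟩
    have hI : (I : FractionalIdeal (𝓞 K)⁰ K) ≠ 0 := I.ne_zero
    -- the basis `B i = toMixed⁻¹(c · j(b i))` of `V` inside `Λ`, and its inner-product dual basis `d`
    set b := basisOfFractionalIdeal K I with hb
    set B : Module.Basis (Module.Free.ChooseBasisIndex ℤ I) ℝ (euclidean.mixedSpace K) :=
      (fractionalIdealLatticeBasis K I).map (latticeEquiv K c hc).symm.toLinearEquiv with hB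
    have hBapply : ∀ i, B i = (euclidean.toMixed K).symm (scaleMixed K c (mixedEmbedding K (b i))) := by
      intro i
      rw [hB, Module.Basis.map_apply, fractionalIdealLatticeBasis_apply]
      rfl
    have hBmem : ∀ i, B i ∈ scaledIdealLattice c hc I := fun i ↦
      mem_scaledIdealLattice.mpr ⟨b i, (mem_span_basisOfFractionalIdeal K).mp (subset_span ⟨i, rfl⟩),
        hBapply i⟩
    set d := LinearMap.BilinForm.dualBasis (innerₗ (euclidean.mixedSpace K)) Literature.Algebra.EuclideanLattices.innerₗ_nondegenerate B
      with hd
    -- the integral pairings `n i = ⟪x, B i⟫`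
    have hn : ∀ i, ∃ n : ℤ, (n : ℝ) = inner ℝ x (B i) := fun i ↦
      (Literature.Algebra.EuclideanLattices.mem_dualLattice.mp hx) (B i) (hBmem i)
    choose n hn using hn
    -- the trace-dual basis and the candidate preimage
    set bd := (Algebra.traceForm ℚ K).dualBasis (traceForm_nondegenerate ℚ K) b with hbd
    set a' : K := ∑ i, (n i : ℚ) • bd i with ha'
    have ha'mem : a' ∈ FractionalIdeal.dual ℤ ℚ (I : FractionalIdeal (𝓞 K)⁰ K) := by
      rw [mem_dual_iff_mem_span_dualBasis]
      refine Submodule.sum_mem _ fun i _ ↦ ?_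
      rw [Int.cast_smul_eq_zsmul ℚ]
      exact Submodule.smul_mem _ _ (subset_span ⟨i, rfl⟩)
    refine ⟨⟨a', ha'mem⟩, Subtype.ext ?_⟩
    -- compare the pairings with the basis `B`
    have htrace : ∀ i, ((Algebra.trace ℚ K (a' * b i) : ℚ) : ℝ) = n i := by
      intro i
      have h1 : a' * b i = ∑ k, (n k : ℚ) • (bd k * b i) := by
        rw [ha', Finset.sum_mul]
        simp_rw [smul_mul_assoc]
      have h2 : Algebra.trace ℚ K (a' * b i) = n i := by
        rw [h1, map_sum]
        simp_rw [map_smul, ← Algebra.traceForm_apply, hbd, LinearMap.BilinForm.apply_dualBasis_left]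
        simp
      rw [h2]
      push_cast
      rfl
    -- both `x` and the image of `a'` have the same coordinates in the dual basis `d`
    have key : ∀ i, inner ℝ ((euclidean.toMixed K).symm
        (scaleMixed K c⁻¹ (twistMixed (mixedEmbedding K a')))) (B i) = inner ℝ x (B i) := by
      intro i
      rw [← hn i, hBapply, inner_dualVector_latticeVector hc, htrace]
    change (euclidean.toMixed K).symm (scaleMixed K c⁻¹ (twistMixed (mixedEmbedding K a'))) = x
    rw [← d.sum_repr ((euclidean.toMixed K).symm (scaleMixed K c⁻¹ (twistMixed (mixedEmbedding K a')))),
      ← d.sum_repr x]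
    simp_rw [hd, LinearMap.BilinForm.dualBasis_repr_apply, innerₗ_apply_apply, key]

/-- `dualIdealEquivDualLattice` is `a' ↦ toMixed⁻¹(c⁻¹ · *j(a'))` on points. [folklore] -/
@[simp] theorem coe_dualIdealEquivDualLattice_apply (c : InfinitePlace K → ℝ) (hc : ∀ w, c w ≠ 0)
    (I : (FractionalIdeal (𝓞 K)⁰ K)ˣ)
    (a' : (FractionalIdeal.dual ℤ ℚ (I : FractionalIdeal (𝓞 K)⁰ K) : FractionalIdeal (𝓞 K)⁰ K)) :
    ((dualIdealEquivDualLattice c hc I a' : Literature.Algebra.EuclideanLattices.dualLattice (scaledIdealLattice c hc I)) :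
      euclidean.mixedSpace K) =
        (euclidean.toMixed K).symm (scaleMixed K c⁻¹ (twistMixed (mixedEmbedding K (a' : K)))) := rfl

/-! ## The Gaussian `e^{-π‖v‖²}` and Poisson summation -/

/-- **Gaussian versus powers**: `e^{-a r²} ≤ e^{b²/(4a)} (1 + r)^{-b}` for `r ≥ 0`
(`1 + r ≤ e^r` and completing the square). [folklore] -/
theorem exp_neg_mul_sq_le {a b : ℝ} (ha : 0 < a) (hb : 0 ≤ b) {r : ℝ} (hr : 0 ≤ r) :
    Real.exp (-a * r ^ 2) ≤ Real.exp (b ^ 2 / (4 * a)) * (1 + r) ^ (-b) := by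
  have h1 : (1 + r) ^ b ≤ Real.exp (b * r) := by
    calc (1 + r) ^ b ≤ (Real.exp r) ^ b :=
          Real.rpow_le_rpow (by positivity) (by linarith [Real.add_one_le_exp r]) hb
      _ = Real.exp (b * r) := by rw [← Real.exp_mul, mul_comm]
  have h2 : b * r - a * r ^ 2 ≤ b ^ 2 / (4 * a) := by
    have h0 : 0 ≤ a * (r - b / (2 * a)) ^ 2 := by positivity
    have h' : a * (r - b / (2 * a)) ^ 2 = a * r ^ 2 - b * r + b ^ 2 / (4 * a) := by
      field_simp
      ring
    linarith
  have hpos : 0 < (1 + r) ^ b := by positivity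
  rw [Real.rpow_neg (by positivity), ← div_eq_mul_inv, le_div_iff₀ hpos]
  calc Real.exp (-a * r ^ 2) * (1 + r) ^ b ≤ Real.exp (-a * r ^ 2) * Real.exp (b * r) := by gcongr
    _ = Real.exp (b * r - a * r ^ 2) := by rw [← Real.exp_add]; ring_nf
    _ ≤ Real.exp (b ^ 2 / (4 * a)) := Real.exp_le_exp.mpr h2

section Gaussian

variable {V : Type*} [NormedAddCommGroup V] [InnerProductSpace ℝ V] [FiniteDimensional ℝ V]
  [MeasurableSpace V] [BorelSpace V]

/-- The Gaussian `e^{-π‖v‖²}` is its own Fourier transform (Mathlib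
`fourier_gaussian_innerProductSpace`; Neukirch VII (3.2), example). [folklore] -/
theorem fourier_gaussian_pi_eq_self :
    𝓕 (fun v : V ↦ ((Real.exp (-π * ‖v‖ ^ 2) : ℝ) : ℂ)) =
      fun v : V ↦ ((Real.exp (-π * ‖v‖ ^ 2) : ℝ) : ℂ) := by
  have hG : (fun v : V ↦ ((Real.exp (-π * ‖v‖ ^ 2) : ℝ) : ℂ)) =
      fun v ↦ Complex.exp (-(π : ℂ) * (‖v‖ : ℂ) ^ 2) := by
    funext v; push_cast [Complex.ofReal_exp]; ring_nf
  rw [hG]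
  funext w
  rw [fourier_gaussian_innerProductSpace (by simp [Real.pi_pos] : 0 < (π : ℂ).re),
    div_self (Complex.ofReal_ne_zero.mpr Real.pi_ne_zero), Complex.one_cpow, one_mul]
  congr 1
  field_simp

omit [InnerProductSpace ℝ V] [FiniteDimensional ℝ V] [MeasurableSpace V] [BorelSpace V] in
/-- Decay of the Gaussian: `e^{-π‖v‖²} ≤ e^{b²/(4π)} (1 + ‖v‖)^{-b}`. [folklore] -/
theorem norm_gaussian_pi_le {b : ℝ} (hb : 0 ≤ b) (v : V) :
    ‖(((Real.exp (-π * ‖v‖ ^ 2) : ℝ) : ℂ))‖ ≤ Real.exp (b ^ 2 / (4 * π)) * (1 + ‖v‖) ^ (-b) := by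
  rw [Complex.norm_real, Real.norm_eq_abs, abs_of_pos (Real.exp_pos _)]
  exact exp_neg_mul_sq_le Real.pi_pos hb (norm_nonneg v)

/-- **Poisson summation for the Gaussian** over a full lattice `Γ ⊂ V`:
`∑_{g ∈ Γ} e^{-π‖g‖²} = vol(Γ)⁻¹ ∑_{g' ∈ Γ'} e^{-π‖g'‖²}` (Neukirch VII (3.2) applied as in the proof
of (3.6), for `z = i`). [cite: NeukirchANT1999, Ch. VII (3.6)] -/
theorem tsum_gaussian_pi_eq (Γ : Submodule ℤ V) [DiscreteTopology Γ] [IsZLattice ℝ Γ] :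
    ∑' g : Γ, ((Real.exp (-π * ‖(g : V)‖ ^ 2) : ℝ) : ℂ) =
      ((ZLattice.covolume Γ)⁻¹ : ℝ) •
        ∑' g' : Literature.Algebra.EuclideanLattices.dualLattice Γ, ((Real.exp (-π * ‖(g' : V)‖ ^ 2) : ℝ) : ℂ) := by
  set b : ℝ := Module.finrank ℝ V + 1 with hbdef
  have hb : (Module.finrank ℝ V : ℝ) < b := by rw [hbdef]; linarith
  have hb0 : 0 ≤ b := by rw [hbdef]; positivity
  have hGc : Continuous fun v : V ↦ ((Real.exp (-π * ‖v‖ ^ 2) : ℝ) : ℂ) := by fun_prop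
  have hdec : ∀ v : V, ‖(((Real.exp (-π * ‖v‖ ^ 2) : ℝ) : ℂ))‖ ≤
      Real.exp (b ^ 2 / (4 * π)) * (1 + ‖v‖) ^ (-b) := norm_gaussian_pi_le hb0
  have hsum : Summable fun g' : Literature.Algebra.EuclideanLattices.dualLattice Γ ↦
      𝓕 (fun v : V ↦ ((Real.exp (-π * ‖v‖ ^ 2) : ℝ) : ℂ)) g' := by
    rw [fourier_gaussian_pi_eq_self]
    exact Fourier.summable_of_decay_zlattice (Literature.Algebra.EuclideanLattices.dualLattice Γ) hb hdec
  have key := Fourier.tsum_eq_tsum_fourier_of_rpow_decay Γ hGc hb hdec hsum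
  rwa [fourier_gaussian_pi_eq_self] at key

end Gaussian

/-! ## The theta transformation formula -/

/-- **Theta transformation at `t`** (Neukirch VII (3.6) + (5.7) + Ch. I (5.2), as in the proof of
(5.8)): for `t ∈ R_+^*`,
`θ_𝔞(it) = (N(t)^{1/2} 𝔑(𝔞) |d_K|^{1/2})⁻¹ θ_{(𝔞𝔡)⁻¹}(i t⁻¹)`. [cite: NeukirchANT1999, Ch. VII, proof of (5.8)] -/
theorem thetaIdeal_eq_inv_mul_thetaIdeal_dual (I : (FractionalIdeal (𝓞 K)⁰ K)ˣ)
    {t : InfinitePlace K → ℝ} (ht : ∀ w, 0 < t w) :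
    thetaIdeal K I t =
      (Real.sqrt (mixedNorm K t) * ((FractionalIdeal.absNorm (I : FractionalIdeal (𝓞 K)⁰ K) : ℝ) *
        Real.sqrt |(discr K : ℝ)|))⁻¹ *
      thetaIdeal K (FractionalIdeal.dual ℤ ℚ (I : FractionalIdeal (𝓞 K)⁰ K)) (fun w ↦ (t w)⁻¹) := by
  set c : InfinitePlace K → ℝ := fun w ↦ Real.sqrt (mult w * t w) with hcdef
  have hc : ∀ w, c w ≠ 0 := fun w ↦ by
    have : (0 : ℝ) < mult w * t w := mul_pos (Nat.cast_pos.mpr mult_pos) (ht w)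
    exact (Real.sqrt_pos.mpr this).ne'
  have key := tsum_gaussian_pi_eq (scaledIdealLattice c hc I)
  -- the lattice side is `θ_𝔞(it)`
  have hL : ∑' g : scaledIdealLattice c hc I, ((Real.exp (-π * ‖(g : euclidean.mixedSpace K)‖ ^ 2) : ℝ) : ℂ) =
      ((thetaIdeal K I t : ℝ) : ℂ) := by
    rw [← (idealEquivScaledIdealLattice c hc I).tsum_eq, thetaIdeal, Complex.ofReal_tsum]
    refine tsum_congr fun a ↦ ?_
    rw [coe_idealEquivScaledIdealLattice_apply, hcdef, norm_sq_scaleMixed_mixedEmbedding (fun w ↦ (ht w).le),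
      thetaSummand]
  -- the dual side is `θ_{(𝔞𝔡)⁻¹}(i t⁻¹)`
  have hR : ∑' g' : Literature.Algebra.EuclideanLattices.dualLattice (scaledIdealLattice c hc I),
      ((Real.exp (-π * ‖(g' : euclidean.mixedSpace K)‖ ^ 2) : ℝ) : ℂ) =
        ((thetaIdeal K (FractionalIdeal.dual ℤ ℚ (I : FractionalIdeal (𝓞 K)⁰ K)) (fun w ↦ (t w)⁻¹) : ℝ) : ℂ) := by
    rw [← (dualIdealEquivDualLattice c hc I).tsum_eq, thetaIdeal, Complex.ofReal_tsum]
    refine tsum_congr fun a' ↦ ?_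
    rw [coe_dualIdealEquivDualLattice_apply, hcdef, norm_sq_scaleMixed_inv_twistMixed ht, thetaSummand]
  rw [hL, hR, covolume_scaledIdealLattice_sqrt ht hc I, Complex.real_smul] at key
  exact_mod_cast key

variable (K) in
/-- **Theta transformation formula for ideals** — discharge of the named fact
`Literature.NumberTheory.LFunctions.NumberField.thetaIdeal_inv` (Neukirch VII (3.6) for `Γ = 𝔞`, `z = iy`, with (5.7) and
Ch. I (5.2), as combined in the proof of (5.8)): for every nonzero fractional ideal `𝔞` and
`y ∈ R_+^*`, `θ_𝔞(i y⁻¹) = N(y)^{1/2} / (𝔑(𝔞) √|d_K|) · θ_{(𝔞𝔡)⁻¹}(iy)`.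
[cite: NeukirchANT1999, Ch. VII (3.6), (5.7), proof of (5.8)] -/
theorem thetaIdeal_inv_holds : thetaIdeal_inv K := by
  intro I hI y hy
  lift I to (FractionalIdeal (𝓞 K)⁰ K)ˣ using Ne.isUnit hI
  have hy' : ∀ w, 0 < (y w)⁻¹ := fun w ↦ inv_pos.mpr (hy w)
  have h := thetaIdeal_eq_inv_mul_thetaIdeal_dual I hy'
  simp only [inv_inv] at h
  rw [h]
  have hN : mixedNorm K (fun w ↦ (y w)⁻¹) = (mixedNorm K y)⁻¹ := by
    simp only [mixedNorm, inv_pow, Finset.prod_inv_distrib]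
  rw [hN, Real.sqrt_inv]
  have hNpos : 0 < Real.sqrt (mixedNorm K y) :=
    Real.sqrt_pos.mpr (Finset.prod_pos fun w _ ↦ pow_pos (hy w) _)
  have hI0 : (0 : ℝ) < (FractionalIdeal.absNorm (I : FractionalIdeal (𝓞 K)⁰ K) : ℝ) := by
    have h0 : FractionalIdeal.absNorm (I : FractionalIdeal (𝓞 K)⁰ K) ≠ 0 := by
      rw [ne_eq, FractionalIdeal.absNorm_eq_zero_iff]
      exact I.ne_zero
    have h1 : (0 : ℚ) ≤ FractionalIdeal.absNorm (I : FractionalIdeal (𝓞 K)⁰ K) :=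
      FractionalIdeal.absNorm_nonneg _
    exact_mod_cast lt_of_le_of_ne h1 h0.symm
  have hd : 0 < Real.sqrt |(discr K : ℝ)| :=
    Real.sqrt_pos.mpr (abs_pos.mpr (Int.cast_ne_zero.mpr (discr_ne_zero K)))
  field_simp

/-! ## Hecke's theorem and the equivalence of the two forms of ERH -/

variable (K) in
/-- **Hecke's theorem** — discharge of the named fact `Literature.NumberTheory.LFunctions.exists_isDedekindZetaContinuation`
(E. Hecke 1917; Neukirch VII (5.10) Corollary, (5.11) (i)): the Dedekind zeta function of a
number field has a holomorphic continuation to `ℂ ∖ {1}`. Assembled from the theta transformation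
formula (`thetaIdeal_inv_holds`, this file) and the Mellin-transform argument of
`DedekindZetaMellinProofs.lean` (`exists_isDedekindZetaContinuation_of_thetaIdeal_inv`:
Neukirch VII (5.5), (5.9)). [cite: NeukirchANT1999, Ch. VII (5.11) (i)] -/
theorem exists_isDedekindZetaContinuation_holds : exists_isDedekindZetaContinuation K :=
  exists_isDedekindZetaContinuation_of_thetaIdeal_inv (thetaIdeal_inv_holds K)

variable (K) in
/-- `dedekindZetaCont K` *is* a continuation of `ζ_K` (discharge of
`Literature.NumberTheory.LFunctions.isDedekindZetaContinuation_dedekindZetaCont`: `Classical.epsilon_spec` and Hecke's theorem).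
[folklore] -/
theorem isDedekindZetaContinuation_dedekindZetaCont_holds :
    isDedekindZetaContinuation_dedekindZetaCont K :=
  Classical.epsilon_spec (exists_isDedekindZetaContinuation_holds K)

variable (K) in
/-- **The two forms of ERH are equivalent** — discharge of the named fact
`Literature.NumberTheory.LFunctions.NumberField.extendedRiemannHypothesis_iff'`: `ExtendedRiemannHypothesis K` (zeros of the
`epsilon`-chosen continuation `dedekindZetaCont K` in the open strip lie on `Re s = 1/2`) iff
`ExtendedRiemannHypothesis' K` (the same for *every* continuation). From Hecke's existence theorem
(`exists_isDedekindZetaContinuation_holds`) and the uniqueness of the continuation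
(`NumberField.extendedRiemannHypothesis_iff'_of_exists`, `DedekindZetaProofs.lean`). [folklore] -/
theorem extendedRiemannHypothesis_iff'_holds : NumberField.extendedRiemannHypothesis_iff' K :=
  NumberField.extendedRiemannHypothesis_iff'_of_exists K (exists_isDedekindZetaContinuation_holds K)

end NumberField

end Literature.NumberTheory.LFunctions
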